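/-
Copyright (c) 2026 the pub-hodgecm-mathlib formalisation cell (harness21).  Prover seat hodgecm-mathlib-K2E4-p07 (g3), Track B «K2-LIT» ∕ h413
(stmt-HodgeConjecture-24833), unit «WeakMatrixRigidity» of the line `K2_E4_SingularTransferKappaSign`, socket #22S road: F-C2 (GS-T), the TRANSPORT of the
GL₂ × GL₁ central germ letter (GS^P) to the H-side letter (GS_v′) `sig_K2E3CentralGermStructureSplit` (repaired binder).  2026-09-04.
-/
import Summits.HodgeConjecture.HodgeConjecture.Theorems.K2E3CentralTransferVanishingLocalSplit      -- ★ p855713 (K2E4-p02): T0-loc = the same transport for a VANISHING statement; all frame imports, ★ p855356 `isLocalGRegular_of_cmSplitEquiv`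
import Literature.NumberTheory.Rogawski1990.ExplicitFactorProductFormula                            -- ★ `UnitaryGroup.PlacesOver`
import HarnessLib

/-!
# K2_E4 road (h413 = stmt-HodgeConjecture-24833), socket #22S — F-C2 (GS-T): the H-side central germ structure at a SPLIT place `‹(GS^P) ∀ F› → ‹(GS_v′)›`

Cell `pub/hodgecm-mathlib` (D-0151), Track B «K2-LIT»; dealer K2E4-plan (g2) 00:28:50Z (B) «#22S ROAD — CUT»: F-C1 (GS^P) `K2E3GLTwoCentralGermRamifiedRay` = K2E4-p01 (g3)
(the GL₂ × GL₁ letter over its ★ shell engine A∕B1∕B2∕C1∕C2), F-C2 (GS-T) = THIS FILE (K2E4-p07 (g3)), F-A = ★ p856118 ∕ p856157, F-B (LIFT_v) pool.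

THE THEOREM.  **`centralGermStructureSplit_of_GSP : ‹(GS^P) for every non-archimedean local field F› → ‹(GS_v′)›`**, where (GS_v′) is the H-side letter
`sig_K2E3CentralGermStructureSplit` of `K2/K2E4-p18/g2/sig_K2E4Socket22Inputs.cand.K2E4-p18-g2.lean` (cand :46, 7dbffbb82dc76fe3) with its measure binder REPAIRED
`[IsFiniteMeasureOnCompacts νHv]` ↦ `[νHv.IsHaarMeasure]` (K2E4-p07 (g3) finding: at `νHv = 0` the zero family is canonical and (GS_v) as typed fails — see ★
`K2E4WeakMatrixFiniteTransportSplitOfSocketsR`), and (GS^P) is the frame-free letter on `P = GL₂(F) × GL₁(F)`: at the centre `(z·1₂, c)` there are a ray `γ_n → (z·1₂, c)` of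
elliptic-regular pairs (guards `tr² − 4 det ≠ 0`, `χ_{γ_n.1}(γ_n.2) ≠ 0`), a germ sequence `G` with infinitely many values, constants `λ ≠ 0, λ′`, one canonically normalised
centraliser measure per `n`, such that every smooth `ψ` has `O_{γ_n}^{ν∕ρ}(ψ) = a + b·G_n` for `n ≫ 0` and every canonical `ρ`, with `ψ(z·1₂, c) = λa + λ′b`, and two smooth
test functions with independent germ pairs [Rogawski1990 §8.1 Props. 8.1.1–8.1.3 (Howe ∕ Harish-Chandra germ expansion, `Γ₁^T = (−1)^{q(T)} d(St)⁻¹`);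
HarishChandra1999 Thm. 3.1].

THE PROOF = T0-loc (★ p855713 `K2E3CentralTransferVanishingLocalSplit`) RUN BACKWARDS, no analysis: a split witness `w ∣ v`; the frame
`j = (cmSplitEquivTwo, cmSplitEquivOne) : H_v ≃ₜ* P := GL₂(L_w) × GL₁(L_w)`; `ν := j_* νHv` (Haar); (GS^P) at `(z, c) = (e₁, det j₁((γ_H.2)_v))`, where
`j((γ_H)_v) = (e₁·1₂, c)` (★ `coe_fst_local_eq_smul_one`); the ray `γ_{H,n} := j⁻¹(γ_n)` is `G`-regular (★ p855356 `isLocalGRegular_of_cmSplitEquiv` on the two guards) and tends to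
`(γ_H)_v` (continuity of `j⁻¹`); for smooth `φ` on `H_v` the test function `ψ := φ ∘ j⁻¹` is smooth (★ `IsLocSmooth.comp_homeomorph'`), and at every `G`-regular `a ∈ H_v`
`Φ^{st}_H(a, φ) = classOrbitalIntegral mHv φ ⟦a⟧` (split: stable conjugacy is conjugacy, ★ `stableOrbitalIntegralRel_isLocalStablyConjH_eq_of_split`) `= O_{j a}^{ν∕ρ}(ψ)` for ANY
canonically normalised `ρ` (★ B5-L `classOrbitalIntegral_comp_mulEquiv_eq_orbitalIntegral_of_isCanonical`) — so the germ relation, the value identity and the rank-two witnesses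
transport verbatim (`§1` isolates this one-point transport).

* §1 `stableOrbitalIntegralRel_comp_eq_of_forall_canonical` — the one-point transport `Φ^{st}_H(a, ψ ∘ j) = r` from «`O_p^{ν∕ρ}(ψ) = r` for every canonical `ρ`» at `p = j a`.
* §2 **`centralGermStructureSplit_of_GSP`** — (GS^P) ⟹ (GS_v′).

HONEST LABEL: HC_CM is proved only modulo the 7 printed citations (2 remaining named inputs: hLiu418 = stmt-HodgeConjecture-24832, h413 =
stmt-HodgeConjecture-24833) until rung 0 closes; this file is a `--supports stmt-HodgeConjecture-24833` helper and proves no printed analytic statement ((GS^P) is a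
HYPOTHESIS here, paid by F-C1).

## References
* [Rogawski1990] J. D. Rogawski, *Automorphic Representations of Unitary Groups in Three Variables*, Ann. of Math. Stud. 123 (1990): §4.3 (4.3.1) p. 43; §4.9 pp. 54–55;
  §8.1 Props. 8.1.1–8.1.3 pp. 112–116; §14.2 p. 232.
* [HarishChandra1999AdmissibleDistributions] Harish-Chandra (DeBacker–Sally), *Admissible Invariant Distributions on Reductive p-adic Groups*, AMS ULS 16 (1999), Thm. 3.1.
* [DeitmarEchterhoff2014] A. Deitmar, S. Echterhoff, *Principles of Harmonic Analysis*, 2nd ed. (2014), Thm. 1.5.3.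
-/

set_option autoImplicit false
set_option linter.dupNamespace false

noncomputable section

open MeasureTheory Measure NumberField IsDedekindDomain Matrix Polynomial Filter
open Literature.MeasureTheory.Group
open Literature.NumberTheory.Rogawski1990 Literature.NumberTheory.Automorphic Literature.NumberTheory.GaloisRepresentations
open Literature.AlgebraicGeometry.ShimuraVarieties (unitaryGroup hermForm)
open scoped MatrixGroups Topology

namespace Summit.HodgeConjecture.HodgeConjecture.Cruxes.H413.K2E3CentralGermStructureSplitOfGSP

/-! ## §1 The one-point transport at a split place -/

section Transport

variable (L : Type) [Field L] [NumberField L] [IsCMField L] (v : HeightOneSpectrum (𝓞 ↥(maximalRealSubfield L)))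
  [MeasurableSpace ((UnitaryGroup.cmDatum L 2 (Matrix.of fun i j : Fin 2 => if i.val + j.val + 1 = 2 then (1 : L) else 0)).Local v × (UnitaryGroup.cmDatum L 1 (Matrix.of fun i j : Fin 1 => if i.val + j.val + 1 = 1 then (1 : L) else 0)).Local v)] [BorelSpace ((UnitaryGroup.cmDatum L 2 (Matrix.of fun i j : Fin 2 => if i.val + j.val + 1 = 2 then (1 : L) else 0)).Local v × (UnitaryGroup.cmDatum L 1 (Matrix.of fun i j : Fin 1 => if i.val + j.val + 1 = 1 then (1 : L) else 0)).Local v)]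
  [∀ a : ((UnitaryGroup.cmDatum L 2 (Matrix.of fun i j : Fin 2 => if i.val + j.val + 1 = 2 then (1 : L) else 0)).Local v × (UnitaryGroup.cmDatum L 1 (Matrix.of fun i j : Fin 1 => if i.val + j.val + 1 = 1 then (1 : L) else 0)).Local v), MeasurableSpace (((UnitaryGroup.cmDatum L 2 (Matrix.of fun i j : Fin 2 => if i.val + j.val + 1 = 2 then (1 : L) else 0)).Local v × (UnitaryGroup.cmDatum L 1 (Matrix.of fun i j : Fin 1 => if i.val + j.val + 1 = 1 then (1 : L) else 0)).Local v) ⧸ Subgroup.centralizer ({a} : Set ((UnitaryGroup.cmDatum L 2 (Matrix.of fun i j : Fin 2 => if i.val + j.val + 1 = 2 then (1 : L) else 0)).Local v × (UnitaryGroup.cmDatum L 1 (Matrix.of fun i j : Fin 1 => if i.val + j.val + 1 = 1 then (1 : L) else 0)).Local v)))]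
  [∀ a : ((UnitaryGroup.cmDatum L 2 (Matrix.of fun i j : Fin 2 => if i.val + j.val + 1 = 2 then (1 : L) else 0)).Local v × (UnitaryGroup.cmDatum L 1 (Matrix.of fun i j : Fin 1 => if i.val + j.val + 1 = 1 then (1 : L) else 0)).Local v), BorelSpace (((UnitaryGroup.cmDatum L 2 (Matrix.of fun i j : Fin 2 => if i.val + j.val + 1 = 2 then (1 : L) else 0)).Local v × (UnitaryGroup.cmDatum L 1 (Matrix.of fun i j : Fin 1 => if i.val + j.val + 1 = 1 then (1 : L) else 0)).Local v) ⧸ Subgroup.centralizer ({a} : Set ((UnitaryGroup.cmDatum L 2 (Matrix.of fun i j : Fin 2 => if i.val + j.val + 1 = 2 then (1 : L) else 0)).Local v × (UnitaryGroup.cmDatum L 1 (Matrix.of fun i j : Fin 1 => if i.val + j.val + 1 = 1 then (1 : L) else 0)).Local v)))]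
  {M : Type*} [Group M] [TopologicalSpace M] [IsTopologicalGroup M] [LocallyCompactSpace M] [SecondCountableTopology M] [T2Space M]
  [MeasurableSpace M] [BorelSpace M]
  [∀ p : M, MeasurableSpace (M ⧸ Subgroup.centralizer ({p} : Set M))] [∀ p : M, BorelSpace (M ⧸ Subgroup.centralizer ({p} : Set M))]

/-- **ONE-POINT TRANSPORT at a split place.**  For a split witness `w ∣ v`, a canonical family `mHv` for `(G-regular, νHv)` (`νHv` Haar), a continuous
isomorphism `j : H_v ≃ₜ* M`, a `G`-regular `a ∈ H_v` and `p = j a`: if the centraliser of `p` carries SOME canonically normalised Haar measure and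
`O_p^{(j_*νHv)∕ρ}(ψ) = r` for EVERY canonically normalised `ρ`, then `Φ^{st}_H(a, ψ ∘ j) = r` — stable conjugacy in `H_v` is conjugacy at a split place (★
`stableOrbitalIntegralRel_isLocalStablyConjH_eq_of_split`) and the canonical class orbital integral reads through `j` against any canonical `ρ` (★ B5-L).
[cite: Rogawski1990, §4.3 (4.3.1) p. 43; §14.2 p. 232] [cite: DeitmarEchterhoff2014, Thm. 1.5.3] -/
theorem stableOrbitalIntegralRel_comp_eq_of_forall_canonical (w : UnitaryGroup.PlacesOver L v) (hw : IsCMField.complexConj L • w.1 ≠ w.1)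
    (νHv : Measure ((UnitaryGroup.cmDatum L 2 (Matrix.of fun i j : Fin 2 => if i.val + j.val + 1 = 2 then (1 : L) else 0)).Local v × (UnitaryGroup.cmDatum L 1 (Matrix.of fun i j : Fin 1 => if i.val + j.val + 1 = 1 then (1 : L) else 0)).Local v)) [νHv.IsHaarMeasure] [νHv.IsMulRightInvariant]
    (mHv : OrbitalMeasureFamily ((UnitaryGroup.cmDatum L 2 (Matrix.of fun i j : Fin 2 => if i.val + j.val + 1 = 2 then (1 : L) else 0)).Local v × (UnitaryGroup.cmDatum L 1 (Matrix.of fun i j : Fin 1 => if i.val + j.val + 1 = 1 then (1 : L) else 0)).Local v)) (hcanH : mHv.IsCanonical (IsLocalGRegular L v) νHv)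
    (j : ((UnitaryGroup.cmDatum L 2 (Matrix.of fun i j : Fin 2 => if i.val + j.val + 1 = 2 then (1 : L) else 0)).Local v × (UnitaryGroup.cmDatum L 1 (Matrix.of fun i j : Fin 1 => if i.val + j.val + 1 = 1 then (1 : L) else 0)).Local v) ≃ₜ* M) (νM : Measure M) [νM.IsHaarMeasure] [νM.IsMulRightInvariant] (hνM : νM = Measure.map j νHv)
    (a : ((UnitaryGroup.cmDatum L 2 (Matrix.of fun i j : Fin 2 => if i.val + j.val + 1 = 2 then (1 : L) else 0)).Local v × (UnitaryGroup.cmDatum L 1 (Matrix.of fun i j : Fin 1 => if i.val + j.val + 1 = 1 then (1 : L) else 0)).Local v)) (ha : IsLocalGRegular L v a) (p : M) (hp : j a = p) (ψ : M → ℂ) (r : ℂ)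
    (hex : ∃ ρ : Measure ↥(Subgroup.centralizer ({p} : Set M)), ρ.IsHaarMeasure ∧ ρ.IsInvInvariant ∧ ρ (compactCore ↥(Subgroup.centralizer ({p} : Set M))) = 1)
    (h : ∀ (ρ : Measure ↥(Subgroup.centralizer ({p} : Set M))) [ρ.IsHaarMeasure] [ρ.IsInvInvariant],
      ρ (compactCore ↥(Subgroup.centralizer ({p} : Set M))) = 1 →
        orbitalIntegral p ψ (quotientMeasure (Subgroup.centralizer ({p} : Set M)) ρ (isClosed_coe_centralizer_singleton p) νM) = r) :
    stableOrbitalIntegralRel (IsLocalStablyConjH L v) mHv (fun x => ψ (j x)) a = r := by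
  subst hp
  obtain ⟨ρ, hρ, hρi, hρ1⟩ := hex
  haveI := hρ
  haveI := hρi
  rw [stableOrbitalIntegralRel_isLocalStablyConjH_eq_of_split L w hw (UnitaryGroup.antidiagOne_isHermitian L 2)
    (UnitaryGroup.isUnit_antidiagOne_det L 2).ne_zero (UnitaryGroup.antidiagOne_isHermitian L 1) (UnitaryGroup.isUnit_antidiagOne_det L 1).ne_zero mHv _ a]
  have hcomp : (fun x => ψ (j x)) = ψ ∘ j.toMulEquiv := rfl
  rw [hcomp, classOrbitalIntegral_comp_mulEquiv_eq_orbitalIntegral_of_isCanonical j.toMulEquiv j.continuous j.symm.continuous hcanH a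
    (isLocalGRegular_out_mk ha) νM hνM ρ hρ1 ψ]
  exact h ρ hρ1

end Transport

/-! ## §2 (GS^P) ⟹ (GS_v′) -/

set_option maxHeartbeats 1600000 in
set_option synthInstance.maxHeartbeats 400000 in
/-- **F-C2 (GS-T): the H-side central germ structure at a split place from the GL₂ × GL₁ letter (GS^P).**  Conclusion = (GS_v′) (cand :46 of 7dbffbb82dc76fe3 with
`[νHv.IsHaarMeasure]`), hypothesis = (GS^P) for every non-archimedean local field `F : Type` — K2E4-p01 (g3)'s F-C1 head `K2/K2E4-p01/g3/GSP.sig.lean` v2 (sha16 23bb8bcde4c61eea)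
`K2E3GLTwoCentralGermRamifiedRay.exists_ellipticRay_orbitalIntegral_eq_add_mul` VERBATIM as a `∀`-closed binder (its `{F : Type*}` read at universe 0, where `L_w` lives;
the payer instantiates the universe-polymorphic ★ theorem there).  Transport along
`j = (cmSplitEquivTwo, cmSplitEquivOne)`; see the module docstring.
[cite: Rogawski1990, §8.1 Props. 8.1.1–8.1.3 pp. 112–116; §4.3 (4.3.1) p. 43; §14.2 p. 232] [cite: HarishChandra1999AdmissibleDistributions, Thm. 3.1] -/
theorem centralGermStructureSplit_of_GSP
    (hGSP : ∀ {F : Type} [Field F] [ValuativeRel F] [TopologicalSpace F] [IsNonarchimedeanLocalField F]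
      [MeasurableSpace (GL (Fin 2) F × GL (Fin 1) F)] [BorelSpace (GL (Fin 2) F × GL (Fin 1) F)]
      [T2Space (GL (Fin 2) F × GL (Fin 1) F)] [LocallyCompactSpace (GL (Fin 2) F × GL (Fin 1) F)]
      [SecondCountableTopology (GL (Fin 2) F × GL (Fin 1) F)]
      [∀ γ : GL (Fin 2) F × GL (Fin 1) F,
        MeasurableSpace ((GL (Fin 2) F × GL (Fin 1) F) ⧸ Subgroup.centralizer ({γ} : Set (GL (Fin 2) F × GL (Fin 1) F)))]
      [∀ γ : GL (Fin 2) F × GL (Fin 1) F,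
        BorelSpace ((GL (Fin 2) F × GL (Fin 1) F) ⧸ Subgroup.centralizer ({γ} : Set (GL (Fin 2) F × GL (Fin 1) F)))]
      (ν : Measure (GL (Fin 2) F × GL (Fin 1) F)) [ν.IsHaarMeasure] [ν.IsMulRightInvariant] (z c : Fˣ),
      ∃ (γ : ℕ → GL (Fin 2) F × GL (Fin 1) F) (G : ℕ → ℂ) (lam lam' : ℂ),
        (∀ n, ((γ n).1 : Matrix (Fin 2) (Fin 2) F).trace ^ 2 - 4 * ((γ n).1 : Matrix (Fin 2) (Fin 2) F).det ≠ 0 ∧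
          (((γ n).1 : Matrix (Fin 2) (Fin 2) F).charpoly).eval (((γ n).2 : Matrix (Fin 1) (Fin 1) F) 0 0) ≠ 0) ∧
        (∀ n, ∃ ρ : Measure (Subgroup.centralizer ({γ n} : Set (GL (Fin 2) F × GL (Fin 1) F))),
          ρ.IsHaarMeasure ∧ ρ.IsInvInvariant ∧ ρ (compactCore (Subgroup.centralizer ({γ n} : Set (GL (Fin 2) F × GL (Fin 1) F)))) = 1) ∧
        Tendsto γ atTop (𝓝 (Units.map (Matrix.scalar (Fin 2) : F →+* Matrix (Fin 2) (Fin 2) F).toMonoidHom z,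
          Units.map (Matrix.scalar (Fin 1) : F →+* Matrix (Fin 1) (Fin 1) F).toMonoidHom c)) ∧
        (Set.range G).Infinite ∧ lam ≠ 0 ∧
        (∀ ψ : GL (Fin 2) F × GL (Fin 1) F → ℂ, IsLocSmooth ψ →
          ∃ a b : ℂ,
            (∀ᶠ n in atTop, ∀ (ρ : Measure (Subgroup.centralizer ({γ n} : Set (GL (Fin 2) F × GL (Fin 1) F))))
                [ρ.IsHaarMeasure] [ρ.IsInvInvariant],
                ρ (compactCore (Subgroup.centralizer ({γ n} : Set (GL (Fin 2) F × GL (Fin 1) F)))) = 1 →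
                orbitalIntegral (γ n) ψ
                  (quotientMeasure (Subgroup.centralizer ({γ n} : Set (GL (Fin 2) F × GL (Fin 1) F))) ρ
                    (isClosed_coe_centralizer_singleton (γ n)) ν) = a + b * G n) ∧
            ψ (Units.map (Matrix.scalar (Fin 2) : F →+* Matrix (Fin 2) (Fin 2) F).toMonoidHom z,
                Units.map (Matrix.scalar (Fin 1) : F →+* Matrix (Fin 1) (Fin 1) F).toMonoidHom c) = lam * a + lam' * b) ∧
        (∃ (ψ₁ ψ₂ : GL (Fin 2) F × GL (Fin 1) F → ℂ) (a₁ b₁ a₂ b₂ : ℂ), IsLocSmooth ψ₁ ∧ IsLocSmooth ψ₂ ∧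
          (∀ᶠ n in atTop, ∀ (ρ : Measure (Subgroup.centralizer ({γ n} : Set (GL (Fin 2) F × GL (Fin 1) F))))
              [ρ.IsHaarMeasure] [ρ.IsInvInvariant],
              ρ (compactCore (Subgroup.centralizer ({γ n} : Set (GL (Fin 2) F × GL (Fin 1) F)))) = 1 →
              orbitalIntegral (γ n) ψ₁
                (quotientMeasure (Subgroup.centralizer ({γ n} : Set (GL (Fin 2) F × GL (Fin 1) F))) ρ
                  (isClosed_coe_centralizer_singleton (γ n)) ν) = a₁ + b₁ * G n) ∧
          (∀ᶠ n in atTop, ∀ (ρ : Measure (Subgroup.centralizer ({γ n} : Set (GL (Fin 2) F × GL (Fin 1) F))))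
              [ρ.IsHaarMeasure] [ρ.IsInvInvariant],
              ρ (compactCore (Subgroup.centralizer ({γ n} : Set (GL (Fin 2) F × GL (Fin 1) F)))) = 1 →
              orbitalIntegral (γ n) ψ₂
                (quotientMeasure (Subgroup.centralizer ({γ n} : Set (GL (Fin 2) F × GL (Fin 1) F))) ρ
                  (isClosed_coe_centralizer_singleton (γ n)) ν) = a₂ + b₂ * G n) ∧
          a₁ * b₂ - a₂ * b₁ ≠ 0)) :
    ∀ (L : Type) [Field L] [NumberField L] [IsCMField L] (v : HeightOneSpectrum (𝓞 ↥(maximalRealSubfield L))),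
      ¬ Subsingleton (UnitaryGroup.PlacesOver L v) →
    ∀
      [MeasurableSpace ((UnitaryGroup.cmDatum L 2 (Matrix.of fun i j : Fin 2 => if i.val + j.val + 1 = 2 then (1 : L) else 0)).Local v × (UnitaryGroup.cmDatum L 1 (Matrix.of fun i j : Fin 1 => if i.val + j.val + 1 = 1 then (1 : L) else 0)).Local v)] [BorelSpace ((UnitaryGroup.cmDatum L 2 (Matrix.of fun i j : Fin 2 => if i.val + j.val + 1 = 2 then (1 : L) else 0)).Local v × (UnitaryGroup.cmDatum L 1 (Matrix.of fun i j : Fin 1 => if i.val + j.val + 1 = 1 then (1 : L) else 0)).Local v)]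
      [∀ a : ((UnitaryGroup.cmDatum L 2 (Matrix.of fun i j : Fin 2 => if i.val + j.val + 1 = 2 then (1 : L) else 0)).Local v × (UnitaryGroup.cmDatum L 1 (Matrix.of fun i j : Fin 1 => if i.val + j.val + 1 = 1 then (1 : L) else 0)).Local v),
        MeasurableSpace (((UnitaryGroup.cmDatum L 2 (Matrix.of fun i j : Fin 2 => if i.val + j.val + 1 = 2 then (1 : L) else 0)).Local v × (UnitaryGroup.cmDatum L 1 (Matrix.of fun i j : Fin 1 => if i.val + j.val + 1 = 1 then (1 : L) else 0)).Local v) ⧸ Subgroup.centralizer ({a} : Set ((UnitaryGroup.cmDatum L 2 (Matrix.of fun i j : Fin 2 => if i.val + j.val + 1 = 2 then (1 : L) else 0)).Local v × (UnitaryGroup.cmDatum L 1 (Matrix.of fun i j : Fin 1 => if i.val + j.val + 1 = 1 then (1 : L) else 0)).Local v)))]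
      [∀ a : ((UnitaryGroup.cmDatum L 2 (Matrix.of fun i j : Fin 2 => if i.val + j.val + 1 = 2 then (1 : L) else 0)).Local v × (UnitaryGroup.cmDatum L 1 (Matrix.of fun i j : Fin 1 => if i.val + j.val + 1 = 1 then (1 : L) else 0)).Local v),
        BorelSpace (((UnitaryGroup.cmDatum L 2 (Matrix.of fun i j : Fin 2 => if i.val + j.val + 1 = 2 then (1 : L) else 0)).Local v × (UnitaryGroup.cmDatum L 1 (Matrix.of fun i j : Fin 1 => if i.val + j.val + 1 = 1 then (1 : L) else 0)).Local v) ⧸ Subgroup.centralizer ({a} : Set ((UnitaryGroup.cmDatum L 2 (Matrix.of fun i j : Fin 2 => if i.val + j.val + 1 = 2 then (1 : L) else 0)).Local v × (UnitaryGroup.cmDatum L 1 (Matrix.of fun i j : Fin 1 => if i.val + j.val + 1 = 1 then (1 : L) else 0)).Local v)))]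
      (νHv : Measure ((UnitaryGroup.cmDatum L 2 (Matrix.of fun i j : Fin 2 => if i.val + j.val + 1 = 2 then (1 : L) else 0)).Local v × (UnitaryGroup.cmDatum L 1 (Matrix.of fun i j : Fin 1 => if i.val + j.val + 1 = 1 then (1 : L) else 0)).Local v)) [νHv.IsHaarMeasure] [νHv.IsMulRightInvariant]
      (mHv : OrbitalMeasureFamily ((UnitaryGroup.cmDatum L 2 (Matrix.of fun i j : Fin 2 => if i.val + j.val + 1 = 2 then (1 : L) else 0)).Local v × (UnitaryGroup.cmDatum L 1 (Matrix.of fun i j : Fin 1 => if i.val + j.val + 1 = 1 then (1 : L) else 0)).Local v)),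
      mHv.IsCanonical (IsLocalGRegular L v) νHv →
    ∀ (γH : (UnitaryGroup.cmDatum L 2 (Matrix.of fun i j : Fin 2 => if i.val + j.val + 1 = 2 then (1 : L) else 0)).Rational × (UnitaryGroup.cmDatum L 1 (Matrix.of fun i j : Fin 1 => if i.val + j.val + 1 = 1 then (1 : L) else 0)).Rational) (e₁ e₂ : L), e₁ ≠ e₂ →
      (((γH.1 : unitaryGroup (cmConjRingHom L) (Matrix.of fun i j : Fin 2 => if i.val + j.val + 1 = 2 then (1 : L) else 0)).val : GL (Fin 2) L) : Matrix (Fin 2) (Fin 2) L) = e₁ • (1 : Matrix (Fin 2) (Fin 2) L) →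
      (((γH.2 : unitaryGroup (cmConjRingHom L) (Matrix.of fun i j : Fin 1 => if i.val + j.val + 1 = 1 then (1 : L) else 0)).val : GL (Fin 1) L) : Matrix (Fin 1) (Fin 1) L) 0 0 = e₂ →
    ∃ (γ : ℕ → ((UnitaryGroup.cmDatum L 2 (Matrix.of fun i j : Fin 2 => if i.val + j.val + 1 = 2 then (1 : L) else 0)).Local v × (UnitaryGroup.cmDatum L 1 (Matrix.of fun i j : Fin 1 => if i.val + j.val + 1 = 1 then (1 : L) else 0)).Local v)) (G : ℕ → ℂ) (lam lam' : ℂ),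
      (∀ n, IsLocalGRegular L v (γ n)) ∧
      Tendsto γ atTop (nhds
        ((UnitaryGroup.cmDatum L 2 (Matrix.of fun i j : Fin 2 => if i.val + j.val + 1 = 2 then (1 : L) else 0)).toLocal v ((UnitaryGroup.cmDatum L 2 (Matrix.of fun i j : Fin 2 => if i.val + j.val + 1 = 2 then (1 : L) else 0)).toAdelic γH.1),
          (UnitaryGroup.cmDatum L 1 (Matrix.of fun i j : Fin 1 => if i.val + j.val + 1 = 1 then (1 : L) else 0)).toLocal v ((UnitaryGroup.cmDatum L 1 (Matrix.of fun i j : Fin 1 => if i.val + j.val + 1 = 1 then (1 : L) else 0)).toAdelic γH.2))) ∧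
      (Set.range G).Infinite ∧ lam ≠ 0 ∧
      (∀ φ : ((UnitaryGroup.cmDatum L 2 (Matrix.of fun i j : Fin 2 => if i.val + j.val + 1 = 2 then (1 : L) else 0)).Local v × (UnitaryGroup.cmDatum L 1 (Matrix.of fun i j : Fin 1 => if i.val + j.val + 1 = 1 then (1 : L) else 0)).Local v) → ℂ, IsLocSmooth φ →
        ∃ a b : ℂ, (∀ᶠ n in atTop, stableOrbitalIntegralRel (IsLocalStablyConjH L v) mHv φ (γ n) = a + b * G n) ∧
          φ ((UnitaryGroup.cmDatum L 2 (Matrix.of fun i j : Fin 2 => if i.val + j.val + 1 = 2 then (1 : L) else 0)).toLocal v ((UnitaryGroup.cmDatum L 2 (Matrix.of fun i j : Fin 2 => if i.val + j.val + 1 = 2 then (1 : L) else 0)).toAdelic γH.1),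
          (UnitaryGroup.cmDatum L 1 (Matrix.of fun i j : Fin 1 => if i.val + j.val + 1 = 1 then (1 : L) else 0)).toLocal v ((UnitaryGroup.cmDatum L 1 (Matrix.of fun i j : Fin 1 => if i.val + j.val + 1 = 1 then (1 : L) else 0)).toAdelic γH.2)) = lam * a + lam' * b) ∧
      (∃ (φ₁ φ₂ : ((UnitaryGroup.cmDatum L 2 (Matrix.of fun i j : Fin 2 => if i.val + j.val + 1 = 2 then (1 : L) else 0)).Local v × (UnitaryGroup.cmDatum L 1 (Matrix.of fun i j : Fin 1 => if i.val + j.val + 1 = 1 then (1 : L) else 0)).Local v) → ℂ) (a₁ b₁ a₂ b₂ : ℂ), IsLocSmooth φ₁ ∧ IsLocSmooth φ₂ ∧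
        (∀ᶠ n in atTop, stableOrbitalIntegralRel (IsLocalStablyConjH L v) mHv φ₁ (γ n) = a₁ + b₁ * G n) ∧
        (∀ᶠ n in atTop, stableOrbitalIntegralRel (IsLocalStablyConjH L v) mHv φ₂ (γ n) = a₂ + b₂ * G n) ∧ a₁ * b₂ - a₂ * b₁ ≠ 0) := by
  intro L _ _ _ v hns _ _ _ _ νHv _ _ mHv hcanH γH e₁ e₂ hne hγH₁ hγH₂
  classical
  -- (0) a split witness `w`, the local field `F = L_w`, the target group `P = GL₂(F) × GL₁(F)` and its structures (as ★ T0-loc)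
  obtain ⟨w, hw⟩ := K2E4ExplicitSplitConstantPhase.exists_smul_ne_of_not_subsingleton L v hns
  haveI : LocallyCompactSpace (GL (Fin 2) (w.1.adicCompletion L)) := UnitaryGroup.locallyCompactSpace_gl_adicCompletion L 2 w.1
  haveI : LocallyCompactSpace (GL (Fin 1) (w.1.adicCompletion L)) := UnitaryGroup.locallyCompactSpace_gl_adicCompletion L 1 w.1
  haveI : SecondCountableTopology (GL (Fin 2) (w.1.adicCompletion L)) := UnitaryGroup.secondCountableTopology_gl_adicCompletion L 2 w.1
  haveI : SecondCountableTopology (GL (Fin 1) (w.1.adicCompletion L)) := UnitaryGroup.secondCountableTopology_gl_adicCompletion L 1 w.1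
  letI : MeasurableSpace (GL (Fin 2) (w.1.adicCompletion L) × GL (Fin 1) (w.1.adicCompletion L)) := borel _
  haveI : BorelSpace (GL (Fin 2) (w.1.adicCompletion L) × GL (Fin 1) (w.1.adicCompletion L)) := ⟨rfl⟩
  letI : ∀ γ : GL (Fin 2) (w.1.adicCompletion L) × GL (Fin 1) (w.1.adicCompletion L),
      MeasurableSpace ((GL (Fin 2) (w.1.adicCompletion L) × GL (Fin 1) (w.1.adicCompletion L)) ⧸
        Subgroup.centralizer ({γ} : Set (GL (Fin 2) (w.1.adicCompletion L) × GL (Fin 1) (w.1.adicCompletion L)))) := fun _ => borel _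
  haveI : ∀ γ : GL (Fin 2) (w.1.adicCompletion L) × GL (Fin 1) (w.1.adicCompletion L),
      BorelSpace ((GL (Fin 2) (w.1.adicCompletion L) × GL (Fin 1) (w.1.adicCompletion L)) ⧸
        Subgroup.centralizer ({γ} : Set (GL (Fin 2) (w.1.adicCompletion L) × GL (Fin 1) (w.1.adicCompletion L)))) := fun _ => ⟨rfl⟩
  -- the frame `j = (j₂, j₁) : H_v ≃ₜ* P`
  let jj : ((UnitaryGroup.cmDatum L 2 (Matrix.of fun i j : Fin 2 => if i.val + j.val + 1 = 2 then (1 : L) else 0)).Local v × (UnitaryGroup.cmDatum L 1 (Matrix.of fun i j : Fin 1 => if i.val + j.val + 1 = 1 then (1 : L) else 0)).Local v) ≃ₜ* (GL (Fin 2) (w.1.adicCompletion L) × GL (Fin 1) (w.1.adicCompletion L)) :=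
    { toMulEquiv := MulEquiv.prodCongr (UnitaryGroup.cmSplitEquivTwo L v w hw).toMulEquiv (UnitaryGroup.cmSplitEquivOne L v w hw).toMulEquiv
      continuous_toFun := (UnitaryGroup.cmSplitEquivTwo L v w hw).continuous.prodMap (UnitaryGroup.cmSplitEquivOne L v w hw).continuous
      continuous_invFun :=
        (UnitaryGroup.cmSplitEquivTwo L v w hw).symm.continuous.prodMap (UnitaryGroup.cmSplitEquivOne L v w hw).symm.continuous }
  have hjj : ∀ x, jj x = (UnitaryGroup.cmSplitEquivTwo L v w hw x.1, UnitaryGroup.cmSplitEquivOne L v w hw x.2) := fun _ => rfl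
  have hjjs : ∀ p, jj.symm p = ((UnitaryGroup.cmSplitEquivTwo L v w hw).symm p.1, (UnitaryGroup.cmSplitEquivOne L v w hw).symm p.2) :=
    fun _ => rfl
  -- (1) `G`-regularity of `j⁻¹ p` under the two guards (★ p855356)
  have hreg : ∀ (p : GL (Fin 2) (w.1.adicCompletion L) × GL (Fin 1) (w.1.adicCompletion L)),
      (p.1 : Matrix (Fin 2) (Fin 2) (w.1.adicCompletion L)).trace ^ 2 - 4 * (p.1 : Matrix (Fin 2) (Fin 2) (w.1.adicCompletion L)).det ≠ 0 →
      ((p.1 : Matrix (Fin 2) (Fin 2) (w.1.adicCompletion L)).charpoly).eval ((p.2 : Matrix (Fin 1) (Fin 1) (w.1.adicCompletion L)) 0 0) ≠ 0 →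
      IsLocalGRegular L v (jj.symm p) := by
    intro p hd he
    have h1 : UnitaryGroup.cmSplitEquivTwo L v w hw (jj.symm p).1 = p.1 := by
      rw [hjjs]; exact (UnitaryGroup.cmSplitEquivTwo L v w hw).apply_symm_apply p.1
    have h2 : UnitaryGroup.cmSplitEquivOne L v w hw (jj.symm p).2 = p.2 := by
      rw [hjjs]; exact (UnitaryGroup.cmSplitEquivOne L v w hw).apply_symm_apply p.2
    refine K2E3CentralTransferVanishingSplit.isLocalGRegular_of_cmSplitEquiv L v (jj.symm p) w hw ?_ ?_
    · rw [h1]; exact hd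
    · rw [h1, h2]; exact he
  -- (2) the transported Haar measure `ν := j_* νHv`
  haveI : IsHaarMeasure (Measure.map jj νHv) := jj.isHaarMeasure_map νHv
  haveI : (Measure.map jj νHv).IsMulRightInvariant :=
    isMulRightInvariant_map_mulEquiv_of_isMulRightInvariant jj.toMulEquiv jj.continuous.measurable νHv
  -- (3) the centre on the `P` side: `j (γ_H)_v = (e₁·1₂, c)`
  haveI : CharZero (w.1.adicCompletion L) := charZero_of_injective_algebraMap (algebraMap L (w.1.adicCompletion L)).injective
  have he₁ : e₁ ≠ 0 := by
    intro h0
    have hu := Matrix.isUnits_det_units ((γH.1 : unitaryGroup (cmConjRingHom L) (Matrix.of fun i j : Fin 2 => if i.val + j.val + 1 = 2 then (1 : L) else 0)).val)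
    rw [hγH₁, h0, zero_smul, Matrix.det_zero] at hu
    exact not_isUnit_zero hu
  set z : (w.1.adicCompletion L)ˣ := Units.mk0 (algebraMap L (w.1.adicCompletion L) e₁)
    ((map_ne_zero_iff _ (algebraMap L (w.1.adicCompletion L)).injective).2 he₁) with hz
  set c : (w.1.adicCompletion L)ˣ := Matrix.GeneralLinearGroup.det (UnitaryGroup.cmSplitEquivOne L v w hw
    ((UnitaryGroup.cmDatum L 1 (Matrix.of fun i j : Fin 1 => if i.val + j.val + 1 = 1 then (1 : L) else 0)).toLocal v
      ((UnitaryGroup.cmDatum L 1 (Matrix.of fun i j : Fin 1 => if i.val + j.val + 1 = 1 then (1 : L) else 0)).toAdelic γH.2))) with hc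
  have hjγ : jj (((UnitaryGroup.cmDatum L 2 (Matrix.of fun i j : Fin 2 => if i.val + j.val + 1 = 2 then (1 : L) else 0)).toLocal v ((UnitaryGroup.cmDatum L 2 (Matrix.of fun i j : Fin 2 => if i.val + j.val + 1 = 2 then (1 : L) else 0)).toAdelic γH.1),
          (UnitaryGroup.cmDatum L 1 (Matrix.of fun i j : Fin 1 => if i.val + j.val + 1 = 1 then (1 : L) else 0)).toLocal v ((UnitaryGroup.cmDatum L 1 (Matrix.of fun i j : Fin 1 => if i.val + j.val + 1 = 1 then (1 : L) else 0)).toAdelic γH.2))) =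
      (Units.map (Matrix.scalar (Fin 2) : w.1.adicCompletion L →+* Matrix (Fin 2) (Fin 2) (w.1.adicCompletion L)).toMonoidHom z,
        Units.map (Matrix.scalar (Fin 1) : w.1.adicCompletion L →+* Matrix (Fin 1) (Fin 1) (w.1.adicCompletion L)).toMonoidHom c) := by
    rw [hjj]
    refine Prod.ext (Units.ext ?_) (Units.ext ?_)
    · change ((((UnitaryGroup.cmDatum L 2 (Matrix.of fun i j : Fin 2 => if i.val + j.val + 1 = 2 then (1 : L) else 0)).toLocal v
          ((UnitaryGroup.cmDatum L 2 (Matrix.of fun i j : Fin 2 => if i.val + j.val + 1 = 2 then (1 : L) else 0)).toAdelic γH.1)).val :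
            GL (Fin 2) (UnitaryGroup.LocalRing L v)).val : Matrix (Fin 2) (Fin 2) (UnitaryGroup.LocalRing L v)).map
          (Pi.evalRingHom (fun w : UnitaryGroup.PlacesOver L v => w.1.adicCompletion L) w) =
        Matrix.scalar (Fin 2) (z : w.1.adicCompletion L)
      rw [K2E4ExplicitSplitConstantPhase.coe_fst_local_eq_smul_one L v γH hγH₁, Matrix.map_smul' _ _ _ (map_mul _),
        Matrix.map_one _ (map_zero _) (map_one _), hz, Units.val_mk0, Matrix.scalar_apply, ← Matrix.smul_one_eq_diagonal]
      rfl
    · ext i j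
      fin_cases i; fin_cases j
      rw [hc]
      simp [Matrix.scalar_apply, Matrix.GeneralLinearGroup.val_det_apply]
  have hjγs : jj.symm (Units.map (Matrix.scalar (Fin 2) : w.1.adicCompletion L →+* Matrix (Fin 2) (Fin 2) (w.1.adicCompletion L)).toMonoidHom z,
        Units.map (Matrix.scalar (Fin 1) : w.1.adicCompletion L →+* Matrix (Fin 1) (Fin 1) (w.1.adicCompletion L)).toMonoidHom c) = ((UnitaryGroup.cmDatum L 2 (Matrix.of fun i j : Fin 2 => if i.val + j.val + 1 = 2 then (1 : L) else 0)).toLocal v ((UnitaryGroup.cmDatum L 2 (Matrix.of fun i j : Fin 2 => if i.val + j.val + 1 = 2 then (1 : L) else 0)).toAdelic γH.1),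
          (UnitaryGroup.cmDatum L 1 (Matrix.of fun i j : Fin 1 => if i.val + j.val + 1 = 1 then (1 : L) else 0)).toLocal v ((UnitaryGroup.cmDatum L 1 (Matrix.of fun i j : Fin 1 => if i.val + j.val + 1 = 1 then (1 : L) else 0)).toAdelic γH.2)) := by
    rw [← hjγ, ContinuousMulEquiv.symm_apply_apply]
  -- (4) the letter (GS^P) at `(F, ν, z, c) = (L_w, j_* νHv, e₁, c)`
  obtain ⟨γP, G, lam, lam', hguard, hρex, hlim, hG, hlam, hOI, hrank⟩ := hGSP (Measure.map jj νHv) z c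
  -- the per-point transport, for a fixed `n`
  have htr : ∀ (n : ℕ) (ψ : GL (Fin 2) (w.1.adicCompletion L) × GL (Fin 1) (w.1.adicCompletion L) → ℂ) (r : ℂ),
      (∀ (ρ : Measure ↥(Subgroup.centralizer ({γP n} : Set (GL (Fin 2) (w.1.adicCompletion L) × GL (Fin 1) (w.1.adicCompletion L)))))
        [ρ.IsHaarMeasure] [ρ.IsInvInvariant],
        ρ (compactCore ↥(Subgroup.centralizer ({γP n} : Set (GL (Fin 2) (w.1.adicCompletion L) × GL (Fin 1) (w.1.adicCompletion L))))) = 1 →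
        orbitalIntegral (γP n) ψ (quotientMeasure (Subgroup.centralizer ({γP n} : Set (GL (Fin 2) (w.1.adicCompletion L) × GL (Fin 1) (w.1.adicCompletion L)))) ρ
          (isClosed_coe_centralizer_singleton (γP n)) (Measure.map jj νHv)) = r) →
      stableOrbitalIntegralRel (IsLocalStablyConjH L v) mHv (fun x => ψ (jj x)) (jj.symm (γP n)) = r :=
    fun n ψ r h => stableOrbitalIntegralRel_comp_eq_of_forall_canonical L v w hw νHv mHv hcanH jj (Measure.map jj νHv) rfl
      (jj.symm (γP n)) (hreg (γP n) (hguard n).1 (hguard n).2) (γP n) (jj.apply_symm_apply (γP n)) ψ r (hρex n) h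
  refine ⟨fun n => jj.symm (γP n), G, lam, lam', fun n => hreg (γP n) (hguard n).1 (hguard n).2, ?_, hG, hlam, ?_, ?_⟩
  · -- the ray tends to `(γ_H)_v = j⁻¹ (e₁·1₂, c)`
    rw [← hjγs]
    exact (jj.symm.continuous.tendsto _).comp hlim
  · -- the germ relation and the value identity for every smooth `φ` on `H_v`
    intro φ hφ
    have hψ : IsLocSmooth (fun p : GL (Fin 2) (w.1.adicCompletion L) × GL (Fin 1) (w.1.adicCompletion L) => φ (jj.symm p)) :=
      hφ.comp_homeomorph' jj.symm.toHomeomorph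
    obtain ⟨a, b, hev, hval⟩ := hOI _ hψ
    have hback : (fun x => (fun p : GL (Fin 2) (w.1.adicCompletion L) × GL (Fin 1) (w.1.adicCompletion L) => φ (jj.symm p)) (jj x)) = φ := by
      funext x
      exact congrArg φ (jj.symm_apply_apply x)
    refine ⟨a, b, ?_, ?_⟩
    · filter_upwards [hev] with n hn
      have h := htr n _ (a + b * G n) hn
      rwa [hback] at h
    · rw [← hval, ← hjγ, ContinuousMulEquiv.symm_apply_apply]
  · -- rank two
    obtain ⟨ψ₁, ψ₂, a₁, b₁, a₂, b₂, hs₁, hs₂, h₁, h₂, hD⟩ := hrank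
    refine ⟨fun x => ψ₁ (jj x), fun x => ψ₂ (jj x), a₁, b₁, a₂, b₂, hs₁.comp_homeomorph' jj.toHomeomorph, hs₂.comp_homeomorph' jj.toHomeomorph, ?_, ?_, hD⟩
    · filter_upwards [h₁] with n hn
      exact htr n ψ₁ _ hn
    · filter_upwards [h₂] with n hn
      exact htr n ψ₂ _ hn

end Summit.HodgeConjecture.HodgeConjecture.Cruxes.H413.K2E3CentralGermStructureSplitOfGSP

end
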